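import Summits.BirchSwinnertonDyer.BirchSwinnertonDyer.Theorems.ResidualThetaTransportAtTwoThetaLayerLambdaCongruenceAtTwoCuspSpanRowInduction
import HarnessLib

/-!
# Route `ResidualThetaTransportAtTwo`, cruxes Kan⁺ (stmt-BirchSwinnertonDyer-20688) / node 27436 / 21437: the INDUCTION STEP on the
# odd rows `b = −m` at EVERY odd level `N` — the case `3 ∣ N`

Cell `bsd-wall`, width seat `bsd-wall-rtt-p3-w2` g5 (2026-08-28), memo `Cruxes/ThetaLayerLambdaCongruenceAtTwo/Lines/birth-rows-allodd.md`
§4 (Claim C), residual case. THEOREMS ONLY; `--supports stmt-BirchSwinnertonDyer-20688`; BSD is not proved by this.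

`…CuspSpanRowInduction` (w4 g2) proves the induction step `Rows.chi_eq_zero_row_step` under `3 ∤ N`: the hypothesis enters only in
§2 there (`F z = 0` for units `z ≡ 1 (mod m)`), where an auxiliary integer `D` has to avoid the THREE classes `{0, m⁻¹, −q}`
(`q = (z − 1)/m`) modulo every prime `ℓ ∣ N` — impossible at `ℓ = 3` in general. Here the hypothesis is removed:
* §1 `exists_F_eq_zero_aux'` — the auxiliary unit `x_t` at every odd `N` (only two classes are avoided, fine at `ℓ = 3`).
* §2 `F_eq_zero_of_cast_eq_one_of_three` — the three-class avoidance still works at `ℓ = 3` when two of the classes COINCIDE: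
  `3 ∣ m` (then `m⁻¹` is void) or `z ≡ 1 (mod 3)` (then `−q ≡ 0`). The remaining case `3 ∣ N`, `3 ∤ m`, `z ≡ −1 (mod 3)` is
  reduced to it by one multiplication: `u := −(Dm − 1)` with `D ≡ −m⁻¹ (mod 3)` (forced by `D ∉ {0, m⁻¹}`) is a unit with
  `F u = F(−1) + F(Dm − 1) = 0`, `u ≡ 1 (mod m)` and `u ≡ −1 (mod 3)`, so `z u ≡ 1 (mod 3m)`; hence
  **`F_eq_zero_of_cast_eq_one'`** at every odd `N`.
Sequel `…CuspSpanRowInductionOdd`: `F_eq_zero_of_isUnit'`, `chi_eq_zero_row_step'` — the induction step WITHOUT `3 ∤ N` — all odd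
rows killed by strong induction, the parity reduction, and the node `CuspSpanEvenAtTwo N` at every odd `N`.
The proof body of §1 is that of `…CuspSpanRowInduction` with the prime bound `ℓ ≥ 5` replaced by `ℓ ≥ 3` (adapted, w4 g2).

References: [Rademacher1929] §1; [IrelandRosen1990] Ch. 3–4; [Pollack2003] Conj. 6.3.
-/

set_option autoImplicit false
set_option linter.dupNamespace false

noncomputable section

open scoped MatrixGroups

open CongruenceSubgroup

namespace Summit.BirchSwinnertonDyer.BirchSwinnertonDyer.Theorems.SignedMuAtTwo.Rows

variable {N : ℕ}

/-! ## §0. Small helpers -/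

/-- The primes of an odd `N` are `≥ 3`. [folklore] -/
theorem three_le_of_mem_primeFactors (hN : Odd N) {ℓ : ℕ} (hℓ : ℓ ∈ N.primeFactors) : 3 ≤ ℓ := by
  have hℓp := Nat.prime_of_mem_primeFactors hℓ
  have hℓN : ℓ ∣ N := Nat.dvd_of_mem_primeFactors hℓ
  have h2 : ℓ ≠ 2 := by rintro rfl; exact (Nat.not_even_iff_odd.mpr hN) (even_iff_two_dvd.mpr hℓN)
  have := hℓp.two_le
  omega

/-- A prime factor of an odd `N` is `3` or `≥ 5`. [folklore] -/
theorem eq_three_or_five_le_of_mem_primeFactors (hN : Odd N) {ℓ : ℕ} (hℓ : ℓ ∈ N.primeFactors) : ℓ = 3 ∨ 5 ≤ ℓ := by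
  have hℓp := Nat.prime_of_mem_primeFactors hℓ
  have h3 := three_le_of_mem_primeFactors hN hℓ
  have h4 : ℓ ≠ 4 := by rintro rfl; exact absurd hℓp (by decide)
  omega

/-- In `ZMod 3` a non-zero element other than `1` is `−1`. [folklore] -/
theorem zmod_three_eq_neg_one {x : ZMod 3} (h0 : x ≠ 0) (h1 : x ≠ 1) : x = -1 := by
  revert x; decide

variable {χ : Gamma0 N → ZMod 2}

section Values

variable (hN : Odd N) (m : ℕ) (hm : Odd m)
  (hadd : ∀ γ δ : Gamma0 N, χ (γ * δ) = χ γ + χ δ)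
  (hsmall : ∀ γ : Gamma0 N, ((γ : SL(2, ℤ)) 0 0 + (γ : SL(2, ℤ)) 1 1).natAbs ≤ 2 → χ γ = 0)
  (hkill : ∀ γ : Gamma0 N, (∃ k : ℕ, 1 ≤ k ∧ ((γ : SL(2, ℤ)) 1 1).natAbs = 4 ^ k) → χ γ = 0)
  (hB1 : ∀ β : Gamma0 N, (β : SL(2, ℤ)) 0 1 = -1 → χ β = 0)
  (F : ZMod (m * N) → ZMod 2)
  (hF : ∀ γ : Gamma0 N, (γ : SL(2, ℤ)) 0 1 = -(m : ℤ) → F ((((γ : SL(2, ℤ)) 1 1 : ℤ) : ZMod (m * N))) = χ γ)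
include hN hm hadd hsmall hkill hB1 hF

/-! ## §1. The auxiliary unit `x_t` at every odd level -/

omit hm hsmall hkill in
/-- **The auxiliary unit `x_t` (every odd `N`).** If the row `b = −t` is killed (`gcd(t, m) = 1`), there is a unit `x` mod `mN`
with `F x = 0` and `t x = Dm − 1` for some integer `D` (so `t x ≡ −1 (mod m)`). Construction as in `exists_F_eq_zero_aux`
(`δ₃` avoiding `{0, m/t}` modulo the primes of `N`, all `≥ 3`; `A := m − t δ₃`, `P = (A, −t; ∗, D) ∈ B_t`, `γ = P β₃ ∈ B_m`).
[cite: Pollack2003, Conj. 6.3] -/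
theorem exists_F_eq_zero_aux' (t : ℕ) (htm : Nat.Coprime t m)
    (hrow : ∀ γ : Gamma0 N, (γ : SL(2, ℤ)) 0 1 = -(t : ℤ) → χ γ = 0) :
    ∃ x : ZMod (m * N), IsUnit x ∧ F x = 0 ∧ ∃ D : ℤ, (t : ZMod (m * N)) * x = ((D * m - 1 : ℤ) : ZMod (m * N)) := by
  haveI : NeZero N := ⟨hN.pos.ne'⟩
  have hprime3 : ∀ ℓ ∈ N.primeFactors, 3 ≤ ℓ := fun ℓ hℓ ↦ three_le_of_mem_primeFactors hN hℓ
  -- choose `δ₃`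
  obtain ⟨δ₃, hδ⟩ := exists_int_avoiding (N := N) (fun _ ↦ ({((1 : ℤ), (0 : ℤ)), ((t : ℤ), -(m : ℤ))} : Finset (ℤ × ℤ)))
    (by
      intro ℓ hℓ
      exact lt_of_le_of_lt (Finset.card_image_le.trans Finset.card_le_two) (by have := hprime3 ℓ hℓ; omega))
  have hmem : ∀ ℓ : ℕ, ℓ.Prime → ℓ ∣ N → ℓ ∈ N.primeFactors := fun ℓ hℓ hℓN ↦ Nat.mem_primeFactors.mpr ⟨hℓ, hℓN, hN.pos.ne'⟩
  have hδN : IsCoprime δ₃ (N : ℤ) := by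
    refine isCoprime_int_of_forall_prime_not_dvd δ₃ fun ℓ hℓ hℓN hdvd ↦ ?_
    have hℓ1 : ¬ ((ℓ : ℤ) ∣ (1 : ℤ)) := fun h ↦ hℓ.one_lt.ne' (by exact_mod_cast Int.eq_one_of_dvd_one (by positivity) h)
    have := hδ ℓ (hmem ℓ hℓ hℓN) ((1 : ℤ), (0 : ℤ)) (by simp) hℓ1
    exact this (by simpa using hdvd)
  have hAN : IsCoprime ((m : ℤ) - t * δ₃) (N : ℤ) := by
    refine isCoprime_int_of_forall_prime_not_dvd _ fun ℓ hℓ hℓN hdvd ↦ ?_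
    by_cases hℓt : (ℓ : ℤ) ∣ (t : ℤ)
    · -- then `ℓ ∣ m`, contradicting `gcd(t, m) = 1`
      have hℓm : (ℓ : ℤ) ∣ (m : ℤ) := by
        have := dvd_add hdvd (hℓt.mul_right δ₃); rwa [sub_add_cancel] at this
      have h1 : ℓ ∣ Nat.gcd t m := Nat.dvd_gcd (by exact_mod_cast hℓt) (by exact_mod_cast hℓm)
      rw [htm] at h1
      exact hℓ.one_lt.ne' (Nat.dvd_one.mp h1)
    · have := hδ ℓ (hmem ℓ hℓ hℓN) ((t : ℤ), -(m : ℤ)) (by simp) hℓt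
      apply this
      have e : (t : ℤ) * δ₃ + -(m : ℤ) = -((m : ℤ) - t * δ₃) := by ring
      rw [e]; exact hdvd.neg_right
  -- `P = (A, −t; Nκ, D)` with `A D + t N κ = 1`
  have hAtN : IsCoprime ((m : ℤ) - t * δ₃) ((t : ℤ) * N) := by
    refine IsCoprime.mul_right ?_ hAN
    have hmt : IsCoprime (m : ℤ) (t : ℤ) := Nat.isCoprime_iff_coprime.mpr htm.symm
    have e : (m : ℤ) - t * δ₃ = m + t * (-δ₃) := by ring
    rw [e]; exact hmt.add_mul_left_left _
  obtain ⟨D, κ, hDκ⟩ := hAtN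
  obtain ⟨P, p00, p01, -, p11⟩ := ThetaLayerLambdaCongruenceAtTwo.exists_gamma0_entries (N := N)
    ((m : ℤ) - t * δ₃) (-(t : ℤ)) ((N : ℤ) * κ) D (by linear_combination hDκ) (dvd_mul_right _ _)
  have hP : χ P = 0 := hrow P p01
  obtain ⟨γ, hb, hχ, hd⟩ := exists_row_of_killed hadd hB1 hP (t : ℤ) (by rw [p01]) (m : ℤ) δ₃ (by rw [p00]; ring) hδN
  refine ⟨((((γ : SL(2, ℤ)) 1 1 : ℤ) : ZMod (m * N))), ?_, by rw [hF γ hb, hχ], D, ?_⟩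
  · -- `d(γ)` is a unit mod `mN`
    have hdet := Matrix.SpecialLinearGroup.det_coe (γ : SL(2, ℤ))
    rw [Matrix.det_fin_two, hb] at hdet
    obtain ⟨c, hc⟩ : (N : ℤ) ∣ (γ : SL(2, ℤ)) 1 0 := by
      have h := γ.2; rw [Gamma0_mem] at h; exact (ZMod.intCast_zmod_eq_zero_iff_dvd _ N).mp h
    rw [hc] at hdet
    have hcopd : IsCoprime ((m * N : ℕ) : ℤ) ((γ : SL(2, ℤ)) 1 1) := by
      push_cast
      exact ⟨c, (γ : SL(2, ℤ)) 0 0, by linear_combination hdet⟩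
    exact (ZMod.coe_int_isUnit_iff_isCoprime _ (m * N)).mpr hcopd
  · rw [p11] at hd
    have e := congrArg (Int.cast : ℤ → ZMod (m * N)) hd
    push_cast at e ⊢
    exact e

/-! ## §2. `F` vanishes on the units `≡ 1 (mod m)` — every odd level -/

/-- **`F z = 0` for units `z ≡ 1 (mod m)`, when at the prime `3` (if `3 ∣ N`) either `3 ∣ m` or `z ≡ 1 (mod 3)`.**
Same construction as `F_eq_zero_of_cast_eq_one` (`z = (z ŷ) · y`, `y = Dm − 1`, `z ŷ ≡ D'm − 1`, `D' = (q + D) ŷ`, `q = (z − 1)/m`,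
`D ∉ {0, m⁻¹, −q}` modulo the primes of `N`); at `ℓ = 3` two of the three excluded classes coincide. [cite: Pollack2003, Conj. 6.3] -/
theorem F_eq_zero_of_cast_eq_one_of_three (z : ZMod (m * N)) (hz : IsUnit z)
    (hz1 : ZMod.castHom (dvd_mul_right m N) (ZMod m) z = 1)
    (hz3 : ∀ h3 : 3 ∣ N, 3 ∣ m ∨ ZMod.castHom (Dvd.dvd.mul_left h3 m) (ZMod 3) z = 1) : F z = 0 := by
  haveI : NeZero N := ⟨hN.pos.ne'⟩
  have hm0 : m ≠ 0 := hm.pos.ne'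
  haveI : NeZero (m * N) := ⟨Nat.mul_ne_zero hm0 (NeZero.ne N)⟩
  haveI : NeZero m := ⟨hm0⟩
  -- integer representative and `q`
  set zi : ℤ := (z.val : ℤ) with hzi
  have hzcast : ((zi : ℤ) : ZMod (m * N)) = z := by rw [hzi, Int.cast_natCast, ZMod.natCast_zmod_val]
  obtain ⟨q, hq⟩ : (m : ℤ) ∣ zi - 1 := by
    rw [← ZMod.intCast_zmod_eq_zero_iff_dvd]
    have e : ((zi : ℤ) : ZMod m) = ZMod.castHom (dvd_mul_right m N) (ZMod m) z := by rw [← hzcast, map_intCast]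
    push_cast; rw [e, hz1, sub_self]
  have hzN : IsCoprime zi (N : ℤ) := by
    have h := (ZMod.coe_int_isUnit_iff_isCoprime zi (m * N)).mp (by rw [hzcast]; exact hz)
    push_cast at h
    exact h.symm.of_mul_right_right
  -- the coincidence at `ℓ = 3`
  have hcoin : 3 ∣ N → (3 ∣ m) ∨ ((3 : ℤ) ∣ q) := by
    intro h3N
    rcases hz3 h3N with h3m | h3z
    · exact Or.inl h3m
    · have e : ((zi : ℤ) : ZMod 3) = ZMod.castHom (Dvd.dvd.mul_left h3N m) (ZMod 3) z := by rw [← hzcast, map_intCast]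
      have h30 : (((zi - 1 : ℤ)) : ZMod 3) = 0 := by push_cast; rw [e, h3z, sub_self]
      have h31 : (3 : ℤ) ∣ zi - 1 := by exact_mod_cast (ZMod.intCast_zmod_eq_zero_iff_dvd (zi - 1) 3).mp h30
      rw [hq] at h31
      rcases (Nat.prime_iff_prime_int.mp Nat.prime_three).dvd_or_dvd h31 with h | h
      · exact Or.inl (by exact_mod_cast h)
      · exact Or.inr h
  -- choose `D`
  have hmem : ∀ ℓ : ℕ, ℓ.Prime → ℓ ∣ N → ℓ ∈ N.primeFactors := fun ℓ hℓ hℓN ↦ Nat.mem_primeFactors.mpr ⟨hℓ, hℓN, hN.pos.ne'⟩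
  obtain ⟨D, hD⟩ := exists_int_avoiding (N := N)
    (fun _ ↦ ({((1 : ℤ), (0 : ℤ)), ((m : ℤ), (-1 : ℤ)), ((1 : ℤ), q)} : Finset (ℤ × ℤ)))
    (by
      intro ℓ hℓ
      rcases eq_three_or_five_le_of_mem_primeFactors hN hℓ with rfl | h5
      · -- `ℓ = 3`: two of the three classes coincide
        have h3N : 3 ∣ N := Nat.dvd_of_mem_primeFactors hℓ
        rcases hcoin h3N with h3m | h3q
        · have hm3 : (m : ZMod 3) = 0 := (CharP.cast_eq_zero_iff (ZMod 3) 3 m).mpr h3m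
          refine lt_of_le_of_lt (Finset.card_le_card (Finset.image_subset_iff.mpr ?_))
            (lt_of_le_of_lt (Finset.card_le_two (a := (0 : ZMod 3)) (b := -((q : ℤ) : ZMod 3) * (((1 : ℤ) : ℤ) : ZMod 3)⁻¹))
              (by norm_num))
          intro c hc
          simp only [Finset.mem_insert, Finset.mem_singleton] at hc
          rcases hc with rfl | rfl | rfl
          · simp
          · simp [hm3]
          · simp
        · have hq3 : ((q : ℤ) : ZMod 3) = 0 := (ZMod.intCast_zmod_eq_zero_iff_dvd _ 3).mpr h3q
          refine lt_of_le_of_lt (Finset.card_le_card (Finset.image_subset_iff.mpr ?_))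
            (lt_of_le_of_lt (Finset.card_le_two (a := (0 : ZMod 3)) (b := -(((-1 : ℤ) : ℤ) : ZMod 3) * (((m : ℤ) : ℤ) : ZMod 3)⁻¹))
              (by norm_num))
          intro c hc
          simp only [Finset.mem_insert, Finset.mem_singleton] at hc
          rcases hc with rfl | rfl | rfl
          · simp
          · simp
          · simp [hq3]
      · exact lt_of_le_of_lt (Finset.card_image_le.trans Finset.card_le_three) (by omega))
  have hone : ∀ ℓ : ℕ, ℓ.Prime → ¬ ((ℓ : ℤ) ∣ (1 : ℤ)) := fun ℓ hℓ h ↦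
    hℓ.one_lt.ne' (by exact_mod_cast Int.eq_one_of_dvd_one (by positivity) h)
  have hDN : IsCoprime D (N : ℤ) := isCoprime_int_of_forall_prime_not_dvd D fun ℓ hℓ hℓN hdvd ↦
    hD ℓ (hmem ℓ hℓ hℓN) ((1 : ℤ), (0 : ℤ)) (by simp) (hone ℓ hℓ) (by simpa using hdvd)
  have hyN : IsCoprime (D * m - 1) (N : ℤ) := by
    refine isCoprime_int_of_forall_prime_not_dvd _ fun ℓ hℓ hℓN hdvd ↦ ?_
    by_cases hℓm : (ℓ : ℤ) ∣ (m : ℤ)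
    · have : (ℓ : ℤ) ∣ 1 := by
        have := Int.dvd_sub (hℓm.mul_left D) hdvd
        rwa [show D * (m : ℤ) - (D * m - 1) = 1 by ring] at this
      exact hone ℓ hℓ this
    · exact hD ℓ (hmem ℓ hℓ hℓN) ((m : ℤ), (-1 : ℤ)) (by simp) hℓm (by rw [show (m : ℤ) * D + -1 = D * m - 1 by ring]; exact hdvd)
  have hqDN : IsCoprime (q + D) (N : ℤ) := isCoprime_int_of_forall_prime_not_dvd _ fun ℓ hℓ hℓN hdvd ↦
    hD ℓ (hmem ℓ hℓ hℓN) ((1 : ℤ), q) (by simp) (hone ℓ hℓ) (by rw [show (1 : ℤ) * D + q = q + D by ring]; exact hdvd)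
  -- `y = Dm − 1` is a unit mod `mN`; its inverse `ŷ`
  have hymN : IsCoprime (D * m - 1) ((m * N : ℕ) : ℤ) := by
    push_cast
    refine IsCoprime.mul_right ?_ hyN
    exact ⟨-1, D, by ring⟩
  obtain ⟨yh, w, hyh⟩ := hymN
  have hyhN : IsCoprime yh (N : ℤ) := by
    have : IsCoprime yh ((m * N : ℕ) : ℤ) := ⟨D * m - 1, w, by linear_combination hyh⟩
    push_cast at this
    exact this.of_mul_right_right
  -- `F y = 0` and `F (D'm − 1) = 0` with `D' = (q + D) ŷ`
  have hFy : F (((D * m - 1 : ℤ)) : ZMod (m * N)) = 0 := F_mul_sub_one hN m hadd hB1 F hF D hDN hyN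
  have hD'N : IsCoprime ((q + D) * yh) (N : ℤ) := hqDN.mul_left hyhN
  push_cast at hyh
  have hident : (q + D) * yh * m - 1 = yh * zi + (-(w * m)) * N := by
    have e1 : (q + D) * (m : ℤ) = zi + (D * m - 1) := by linear_combination -hq
    linear_combination yh * e1 + hyh
  have hD'N' : IsCoprime ((q + D) * yh * m - 1) (N : ℤ) := by
    rw [hident]
    exact (hyhN.mul_left hzN).add_mul_right_left _
  have hFy' : F ((((q + D) * yh * m - 1 : ℤ)) : ZMod (m * N)) = 0 := F_mul_sub_one hN m hadd hB1 F hF _ hD'N hD'N'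
  -- assemble: `z = (z ŷ) · y`
  have hmn0 : (m : ZMod (m * N)) * (N : ZMod (m * N)) = 0 := by rw [← Nat.cast_mul, ZMod.natCast_self]
  have hcast1 : ((((q + D) * yh * m - 1 : ℤ)) : ZMod (m * N)) = z * ((yh : ℤ) : ZMod (m * N)) := by
    rw [hident]; push_cast; rw [hzcast]; linear_combination (-(w : ZMod (m * N))) * hmn0
  have hyy : ((yh : ℤ) : ZMod (m * N)) * (((D * m - 1 : ℤ)) : ZMod (m * N)) = 1 := by
    have e := congrArg (Int.cast : ℤ → ZMod (m * N)) hyh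
    push_cast at e ⊢
    linear_combination e - (w : ZMod (m * N)) * hmn0
  have hyu : IsUnit (((D * m - 1 : ℤ)) : ZMod (m * N)) :=
    IsUnit.of_mul_eq_one ((yh : ℤ) : ZMod (m * N)) ((mul_comm _ _).trans hyy)
  have hyhu : IsUnit (((yh : ℤ)) : ZMod (m * N)) := IsUnit.of_mul_eq_one _ hyy
  have e : z = (z * ((yh : ℤ) : ZMod (m * N))) * (((D * m - 1 : ℤ)) : ZMod (m * N)) := by
    rw [mul_assoc, hyy, mul_one]
  rw [e, F_mul hN m hm hadd hsmall hkill F hF _ _ (hz.mul hyhu) hyu, ← hcast1, hFy', hFy, add_zero]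

/-- **`F z = 0` for units `z ≡ 1 (mod m)` — at EVERY odd level `N`.** The case `3 ∣ N`, `3 ∤ m`, `z ≡ −1 (mod 3)` is reduced to
`F_eq_zero_of_cast_eq_one_of_three` by multiplying with `u = −(Dm − 1)`, `D ≡ −m⁻¹ (mod 3)`: `F u = F(−1) + F(Dm − 1) = 0`,
`u ≡ 1 (mod m)`, `u ≡ −1 (mod 3)`. [cite: Pollack2003, Conj. 6.3] -/
theorem F_eq_zero_of_cast_eq_one' (z : ZMod (m * N)) (hz : IsUnit z)
    (hz1 : ZMod.castHom (dvd_mul_right m N) (ZMod m) z = 1) : F z = 0 := by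
  haveI : NeZero N := ⟨hN.pos.ne'⟩
  have hm0 : m ≠ 0 := hm.pos.ne'
  haveI : NeZero (m * N) := ⟨Nat.mul_ne_zero hm0 (NeZero.ne N)⟩
  haveI : NeZero m := ⟨hm0⟩
  by_cases H : ∀ h3 : 3 ∣ N, 3 ∣ m ∨ ZMod.castHom (Dvd.dvd.mul_left h3 m) (ZMod 3) z = 1
  · exact F_eq_zero_of_cast_eq_one_of_three hN m hm hadd hsmall hkill hB1 F hF z hz hz1 H
  obtain ⟨h3N, hH⟩ := not_forall.mp H
  have h3m : ¬ 3 ∣ m := fun h ↦ hH (Or.inl h)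
  have hz3 : ZMod.castHom (Dvd.dvd.mul_left h3N m) (ZMod 3) z ≠ 1 := fun h ↦ hH (Or.inr h)
  set π := ZMod.castHom (dvd_mul_right m N) (ZMod m) with hπ
  set π₃ := ZMod.castHom (Dvd.dvd.mul_left h3N m) (ZMod 3) with hπ₃
  -- `π₃ z = −1`
  have hz3' : π₃ z = -1 := zmod_three_eq_neg_one (hz.map π₃).ne_zero hz3
  -- choose `D ∉ {0, m⁻¹}` modulo the primes of `N`
  have hmem : ∀ ℓ : ℕ, ℓ.Prime → ℓ ∣ N → ℓ ∈ N.primeFactors := fun ℓ hℓ hℓN ↦ Nat.mem_primeFactors.mpr ⟨hℓ, hℓN, hN.pos.ne'⟩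
  obtain ⟨D, hD⟩ := exists_int_avoiding (N := N)
    (fun _ ↦ ({((1 : ℤ), (0 : ℤ)), ((m : ℤ), (-1 : ℤ))} : Finset (ℤ × ℤ)))
    (by
      intro ℓ hℓ
      exact lt_of_le_of_lt (Finset.card_image_le.trans Finset.card_le_two)
        (by have := three_le_of_mem_primeFactors hN hℓ; omega))
  have hone : ∀ ℓ : ℕ, ℓ.Prime → ¬ ((ℓ : ℤ) ∣ (1 : ℤ)) := fun ℓ hℓ h ↦
    hℓ.one_lt.ne' (by exact_mod_cast Int.eq_one_of_dvd_one (by positivity) h)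
  have hDN : IsCoprime D (N : ℤ) := isCoprime_int_of_forall_prime_not_dvd D fun ℓ hℓ hℓN hdvd ↦
    hD ℓ (hmem ℓ hℓ hℓN) ((1 : ℤ), (0 : ℤ)) (by simp) (hone ℓ hℓ) (by simpa using hdvd)
  have hyN : IsCoprime (D * m - 1) (N : ℤ) := by
    refine isCoprime_int_of_forall_prime_not_dvd _ fun ℓ hℓ hℓN hdvd ↦ ?_
    by_cases hℓm : (ℓ : ℤ) ∣ (m : ℤ)
    · have : (ℓ : ℤ) ∣ 1 := by
        have := Int.dvd_sub (hℓm.mul_left D) hdvd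
        rwa [show D * (m : ℤ) - (D * m - 1) = 1 by ring] at this
      exact hone ℓ hℓ this
    · exact hD ℓ (hmem ℓ hℓ hℓN) ((m : ℤ), (-1 : ℤ)) (by simp) hℓm (by rw [show (m : ℤ) * D + -1 = D * m - 1 by ring]; exact hdvd)
  -- `y = Dm − 1`: `F y = 0`, `y` a unit, `π y = −1`, `π₃ y = 1`
  set y : ZMod (m * N) := (((D * m - 1 : ℤ)) : ZMod (m * N)) with hy
  have hFy : F y = 0 := F_mul_sub_one hN m hadd hB1 F hF D hDN hyN
  have hymN : IsCoprime (D * m - 1) ((m * N : ℕ) : ℤ) := by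
    push_cast
    refine IsCoprime.mul_right ?_ hyN
    exact ⟨-1, D, by ring⟩
  have hyu : IsUnit y := (ZMod.coe_int_isUnit_iff_isCoprime _ (m * N)).mpr hymN.symm
  have hπy : π y = -1 := by
    rw [hy, map_intCast]; push_cast; rw [ZMod.natCast_self, mul_zero, zero_sub]
  have hπ₃y : π₃ y = 1 := by
    have h3D : ¬ ((3 : ℤ) ∣ D) := fun h ↦ by
      have := hDN.isUnit_of_dvd' h (by exact_mod_cast h3N)
      exact absurd (Int.isUnit_iff.mp this) (by decide)
    have h3y : ¬ ((3 : ℤ) ∣ D * m - 1) := fun h ↦ by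
      have := hyN.isUnit_of_dvd' h (by exact_mod_cast h3N)
      exact absurd (Int.isUnit_iff.mp this) (by decide)
    have hD3 : ((D : ℤ) : ZMod 3) ≠ 0 := intCast_ne_zero_of_not_dvd h3D
    have hm3 : (m : ZMod 3) ≠ 0 := fun h ↦ h3m ((CharP.cast_eq_zero_iff (ZMod 3) 3 m).mp h)
    have hy3 : ((D * m - 1 : ℤ) : ZMod 3) ≠ 0 := intCast_ne_zero_of_not_dvd h3y
    have hDm : ((D : ℤ) : ZMod 3) * (m : ZMod 3) = -1 := by
      refine zmod_three_eq_neg_one (mul_ne_zero hD3 hm3) fun h1 ↦ hy3 ?_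
      push_cast; rw [h1, sub_self]
    rw [hy, map_intCast]; push_cast at hDm ⊢; rw [hDm]; decide
  -- `u = −y`, `F u = 0`, and `z u ≡ 1 (mod 3m)`
  have hu : IsUnit (-y) := hyu.neg
  have hFu : F (-y) = 0 := by
    rw [show -y = (-1) * y by ring, F_mul hN m hm hadd hsmall hkill F hF _ _ isUnit_one.neg hyu,
      F_neg_one hN m hm hadd hsmall hkill F hF, hFy, add_zero]
  have h1 : π (z * -y) = 1 := by rw [map_mul, map_neg, hz1, hπy, neg_neg, one_mul]
  have h3 : ∀ h3 : 3 ∣ N, 3 ∣ m ∨ ZMod.castHom (Dvd.dvd.mul_left h3 m) (ZMod 3) (z * -y) = 1 := by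
    intro _; right
    show π₃ (z * -y) = 1
    rw [map_mul, map_neg, hz3', hπ₃y]; ring
  have h0 := F_eq_zero_of_cast_eq_one_of_three hN m hm hadd hsmall hkill hB1 F hF (z * -y) (hz.mul hu) h1 h3
  -- `z = (z u) u⁻¹`
  have hFinv : F ((hu.unit⁻¹ : (ZMod (m * N))ˣ) : ZMod (m * N)) = 0 := by
    rw [F_inv hN m hm hadd hsmall hkill F hF, IsUnit.unit_spec]; exact hFu
  have hui : (-y) * ((hu.unit⁻¹ : (ZMod (m * N))ˣ) : ZMod (m * N)) = 1 := IsUnit.mul_val_inv hu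
  have e : z = (z * -y) * ((hu.unit⁻¹ : (ZMod (m * N))ˣ) : ZMod (m * N)) := by rw [mul_assoc, hui, mul_one]
  rw [e, F_mul hN m hm hadd hsmall hkill F hF _ _ (hz.mul hu) (Units.isUnit _), h0, hFinv, add_zero]

end Values

end Summit.BirchSwinnertonDyer.BirchSwinnertonDyer.Theorems.SignedMuAtTwo.Rows

end
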